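import Literature.Analysis.DeBrangesSpaces.DeBrangesPositivity
import Literature.Analysis.DeBrangesSpaces.ReproducingKernel
import HarnessLib

/-!
# Proof of de Branges' positivity theorem in the form of Conrey–Li 2000, Theorem 1

We discharge the named fact `conreyLi2000_thm1` (`DeBrangesPositivity.lean`), following the
printed proof (Conrey–Li, IMRN 2000 = arXiv:math/9812166, §2, proof of Theorem 1, (2.3)–(2.5)):

1. A zero `w` of `E` lies in the strip `−1 < Im w < 0` (Hermite–Biehler, no real zeros, and the
   symmetry `w ↦ w̄ − i` of the zero set coming from `E♯(z) = ε E(z − i)`); hence `E(w ± i) ≠ 0`.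
2. The kernel function `K = K(w, ·)` (entire, `ReproducingKernel.lean`) satisfies the shift
   identity (2.3), `K(z + i) = c · K(w + i, z)` with `c = −ε conj E♯(w)/conj E(w + i)`, so `K` and
   `K(· + i)` are members of `𝓗(E)` in Conrey–Li's sense (2.1) (`hasKernelBound_of_bound`).
3. By the reproducing identity (2.2), `⟨K(·+i), K⟩ = K(w + i)` and, for every member `G` with
   `G(·+i)` a member, `⟨G(·+i), K⟩ + ⟨G, K(·+i)⟩ = (E(w+i) − E(w−i))/E(w+i) · G(w+i)` (2.4).
4. If `Im w ≠ −1/2` then `K(w + i) = 0`; the positivity hypothesis applied to `G + μK` for all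
   `μ ∈ ℂ` (the Schwarz-inequality step (2.5)) forces `(E(w+i) − E(w−i)) G(w+i) = 0`; with the
   member `G(z) = E♯(z)/(z − w − i)ⁿ` (`n` = order of the zero, "dividing out the factor"),
   `G(w + i) ≠ 0`, so `E(w + i) = E(w − i)`, `|E(x + i(1 + y))| = |E(x − iy)|` (`w = x + iy`), and
   strict monotonicity of `|E(x + iy)|` in `y > 0` gives `Im w = −1/2` after all.
5. With `Im w = −1/2`, i.e. `w̄ = w + i`, positivity for `K` itself reads
   `0 ≤ Re ⟨K, K(·+i)⟩ = Re K(w, w + i) = Re conj E′(w) E(w + i)/(2πi)`.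

## References

* J. B. Conrey, X.-J. Li, IMRN 2000:18, 929–940 = arXiv:math/9812166, §2 Theorem 1 (read)
  [ConreyLi2000].
-/

noncomputable section

open scoped Real Topology ComplexConjugate
open _root_.Complex _root_.MeasureTheory _root_.Filter _root_.Set

namespace Literature.Analysis.DeBrangesSpaces

variable {E : ℂ → ℂ}

/-! ### Bookkeeping for the membership conditions -/

/-- For entire `E` (no real zeros) and entire `F`, `x ↦ F(x)/E(x)` is measurable on `ℝ`.
[folklore] -/
theorem aestronglyMeasurable_div (hE : IsHermiteBiehler E) (hreal : ∀ x : ℝ, E x ≠ 0)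
    {F : ℂ → ℂ} (hF : Differentiable ℂ F) :
    AEStronglyMeasurable (fun x : ℝ ↦ F x / E x) volume :=
  aestronglyMeasurable_ofReal_of_differentiableAt fun u hu ↦
    (hF u).div (hE.differentiable u) (hE.ne_zero_of_im_nonneg hreal hu)

/-- `L²`-membership of `F/E` is stable under `F ↦ F + μ G`. [folklore] -/
theorem integrable_sq_add_mul {F G : ℂ → ℂ} (μ : ℂ)
    (hFm : AEStronglyMeasurable (fun x : ℝ ↦ F x / E x) volume)
    (hGm : AEStronglyMeasurable (fun x : ℝ ↦ G x / E x) volume)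
    (hF2 : Integrable fun x : ℝ ↦ ‖F x / E x‖ ^ 2) (hG2 : Integrable fun x : ℝ ↦ ‖G x / E x‖ ^ 2) :
    Integrable fun x : ℝ ↦ ‖(F x + μ * G x) / E x‖ ^ 2 := by
  have hm : AEStronglyMeasurable (fun x : ℝ ↦ (F x + μ * G x) / E x) volume := by
    have : (fun x : ℝ ↦ (F x + μ * G x) / E x) = fun x : ℝ ↦ F x / E x + μ * (G x / E x) := by
      funext x; ring
    rw [this]
    exact hFm.add (hGm.const_mul μ)
  refine Integrable.mono' ((hF2.const_mul 2).add ((hG2.const_mul (‖μ‖ ^ 2)).const_mul 2))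
    (hm.norm.pow 2) (ae_of_all _ fun x ↦ ?_)
  simp only [Pi.add_apply]
  rw [Real.norm_of_nonneg (by positivity), add_div, norm_add_sq_real]
  have h1 : ‖μ * G x / E x‖ = ‖μ‖ * ‖G x / E x‖ := by rw [mul_div_assoc, norm_mul]
  have hi : inner ℝ (F x / E x) (μ * G x / E x) ≤ ‖F x / E x‖ * (‖μ‖ * ‖G x / E x‖) := by
    have := (le_abs_self _).trans (abs_real_inner_le_norm (F x / E x) (μ * G x / E x))
    rwa [h1] at this
  rw [h1]
  nlinarith [hi, norm_nonneg (F x / E x), norm_nonneg (G x / E x), norm_nonneg μ,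
    sq_nonneg (‖F x / E x‖ - ‖μ‖ * ‖G x / E x‖)]

/-- The decay condition is stable under `F ↦ F + μ G`. [folklore] -/
theorem exists_joint_bound_add_mul {F G : ℂ → ℂ} (μ : ℂ)
    (hF : ∃ C R₀ : ℝ, ∀ z : ℂ, 0 < z.im → R₀ ≤ ‖z‖ →
      ‖F z / E z‖ ≤ C / √z.im ∧ ‖sharp F z / E z‖ ≤ C / √z.im)
    (hG : ∃ C R₀ : ℝ, ∀ z : ℂ, 0 < z.im → R₀ ≤ ‖z‖ →
      ‖G z / E z‖ ≤ C / √z.im ∧ ‖sharp G z / E z‖ ≤ C / √z.im) :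
    ∃ C R₀ : ℝ, ∀ z : ℂ, 0 < z.im → R₀ ≤ ‖z‖ →
      ‖(F z + μ * G z) / E z‖ ≤ C / √z.im ∧ ‖sharp (fun u ↦ F u + μ * G u) z / E z‖ ≤ C / √z.im := by
  obtain ⟨C₁, R₁, hF⟩ := hF
  obtain ⟨C₂, R₂, hG⟩ := hG
  refine ⟨max C₁ 0 + ‖μ‖ * max C₂ 0, max R₁ R₂, fun z hz hR ↦ ?_⟩
  have h₁ := hF z hz ((le_max_left _ _).trans hR)
  have h₂ := hG z hz ((le_max_right _ _).trans hR)
  have hs : 0 < √z.im := Real.sqrt_pos.2 hz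
  have e1 : ‖F z / E z‖ ≤ max C₁ 0 / √z.im := h₁.1.trans (by gcongr; exact le_max_left _ _)
  have e2 : ‖G z / E z‖ ≤ max C₂ 0 / √z.im := h₂.1.trans (by gcongr; exact le_max_left _ _)
  have e3 : ‖sharp F z / E z‖ ≤ max C₁ 0 / √z.im :=
    h₁.2.trans (by gcongr; exact le_max_left _ _)
  have e4 : ‖sharp G z / E z‖ ≤ max C₂ 0 / √z.im :=
    h₂.2.trans (by gcongr; exact le_max_left _ _)
  constructor
  · rw [add_div, mul_div_assoc]
    refine (norm_add_le _ _).trans ?_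
    rw [norm_mul, add_div, mul_div_assoc]
    exact add_le_add e1 (mul_le_mul_of_nonneg_left e2 (norm_nonneg _))
  · have : sharp (fun u ↦ F u + μ * G u) z / E z =
        sharp F z / E z + conj μ * (sharp G z / E z) := by
      simp only [sharp, map_add, map_mul]
      ring
    rw [this]
    refine (norm_add_le _ _).trans ?_
    rw [norm_mul, Complex.norm_conj, add_div, mul_div_assoc]
    exact add_le_add e3 (mul_le_mul_of_nonneg_left e4 (norm_nonneg _))

/-- The decay condition is stable under scalar multiplication. [folklore] -/
theorem exists_joint_bound_const_mul {F : ℂ → ℂ} (μ : ℂ)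
    (hF : ∃ C R₀ : ℝ, ∀ z : ℂ, 0 < z.im → R₀ ≤ ‖z‖ →
      ‖F z / E z‖ ≤ C / √z.im ∧ ‖sharp F z / E z‖ ≤ C / √z.im) :
    ∃ C R₀ : ℝ, ∀ z : ℂ, 0 < z.im → R₀ ≤ ‖z‖ →
      ‖μ * F z / E z‖ ≤ C / √z.im ∧ ‖sharp (fun u ↦ μ * F u) z / E z‖ ≤ C / √z.im := by
  obtain ⟨C, R₀, h⟩ := exists_joint_bound_add_mul (E := E) (F := fun _ ↦ (0 : ℂ)) (G := F) μ
    ⟨0, 0, fun z _ _ ↦ by simp [sharp]⟩ hF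
  exact ⟨C, R₀, fun z hz hR ↦ by simpa using h z hz hR⟩

/-! ### Sesquilinear bookkeeping for the scalar product -/

/-- Hermitian symmetry: `⟨F, G⟩ = conj ⟨G, F⟩`. [folklore] -/
theorem deBrangesInner_conj_symm (F G : ℂ → ℂ) :
    deBrangesInner E F G = conj (deBrangesInner E G F) := by
  unfold deBrangesInner
  rw [← integral_conj]
  refine integral_congr_ae (ae_of_all _ fun x ↦ ?_)
  simp only [map_div₀, map_mul, Complex.conj_conj, map_pow, Complex.conj_ofReal]
  ring

/-- Conjugate-linearity in the second variable: `⟨F, a G⟩ = conj a ⟨F, G⟩`. [folklore] -/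
theorem deBrangesInner_const_mul_right (F G : ℂ → ℂ) (a : ℂ) :
    deBrangesInner E F (fun z ↦ a * G z) = conj a * deBrangesInner E F G := by
  unfold deBrangesInner
  rw [← MeasureTheory.integral_const_mul]
  refine integral_congr_ae (ae_of_all _ fun x ↦ ?_)
  simp only [map_mul]
  ring

/-- Expansion of `⟨A + μB, A' + μB'⟩` (all four pairings integrable). [folklore] -/
theorem deBrangesInner_add_mul_expand {A B A' B' : ℂ → ℂ} (μ : ℂ)
    (h1 : Integrable fun x : ℝ ↦ A x * conj (A' x) / ((‖E x‖ : ℂ) ^ 2))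
    (h2 : Integrable fun x : ℝ ↦ A x * conj (B' x) / ((‖E x‖ : ℂ) ^ 2))
    (h3 : Integrable fun x : ℝ ↦ B x * conj (A' x) / ((‖E x‖ : ℂ) ^ 2))
    (h4 : Integrable fun x : ℝ ↦ B x * conj (B' x) / ((‖E x‖ : ℂ) ^ 2)) :
    deBrangesInner E (fun z ↦ A z + μ * B z) (fun z ↦ A' z + μ * B' z) =
      deBrangesInner E A A' + conj μ * deBrangesInner E A B' + μ * deBrangesInner E B A' +
        μ * conj μ * deBrangesInner E B B' := by
  unfold deBrangesInner
  have e0 : (∫ x : ℝ, (A x + μ * B x) * conj (A' x + μ * B' x) / ((‖E x‖ : ℂ) ^ 2)) =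
      ∫ x : ℝ, A x * conj (A' x) / ((‖E x‖ : ℂ) ^ 2)
        + conj μ * (A x * conj (B' x) / ((‖E x‖ : ℂ) ^ 2))
        + μ * (B x * conj (A' x) / ((‖E x‖ : ℂ) ^ 2))
        + μ * conj μ * (B x * conj (B' x) / ((‖E x‖ : ℂ) ^ 2)) := by
    refine integral_congr_ae (ae_of_all _ fun x ↦ ?_)
    simp only [map_add, map_mul]
    ring
  have h2' : Integrable fun x : ℝ ↦ conj μ * (A x * conj (B' x) / ((‖E x‖ : ℂ) ^ 2)) :=
    h2.const_mul _
  have h3' : Integrable fun x : ℝ ↦ μ * (B x * conj (A' x) / ((‖E x‖ : ℂ) ^ 2)) :=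
    h3.const_mul _
  have h4' : Integrable fun x : ℝ ↦ μ * conj μ * (B x * conj (B' x) / ((‖E x‖ : ℂ) ^ 2)) :=
    h4.const_mul _
  have h12 : Integrable fun x : ℝ ↦ A x * conj (A' x) / ((‖E x‖ : ℂ) ^ 2)
      + conj μ * (A x * conj (B' x) / ((‖E x‖ : ℂ) ^ 2)) := h1.add h2'
  have h123 : Integrable fun x : ℝ ↦ A x * conj (A' x) / ((‖E x‖ : ℂ) ^ 2)
      + conj μ * (A x * conj (B' x) / ((‖E x‖ : ℂ) ^ 2))
      + μ * (B x * conj (A' x) / ((‖E x‖ : ℂ) ^ 2)) := h12.add h3'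
  simp only []
  rw [e0, integral_add h123 h4', integral_add h12 h3', integral_add h1 h2',
    MeasureTheory.integral_const_mul, MeasureTheory.integral_const_mul,
    MeasureTheory.integral_const_mul]

/-! ### Members with a bound `1/‖z − p‖ⁿ` -/

/-- For `n ≥ 1` and `0 < b ≤ r`: `1/rⁿ ≤ (1 + b⁻ⁿ)/r`. [folklore] -/
theorem one_div_pow_le {b r : ℝ} {n : ℕ} (hn : 1 ≤ n) (hb : 0 < b) (hbr : b ≤ r) :
    1 / r ^ n ≤ (1 + (b ^ n)⁻¹) / r := by
  have hr : 0 < r := hb.trans_le hbr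
  have hbn : 0 ≤ (b ^ n)⁻¹ := inv_nonneg.2 (pow_nonneg hb.le n)
  rcases le_or_gt 1 r with h1 | h1
  · have : r ≤ r ^ n := by
      calc r = r ^ 1 := (pow_one r).symm
        _ ≤ r ^ n := pow_le_pow_right₀ h1 hn
    calc 1 / r ^ n ≤ 1 / r := one_div_le_one_div_of_le hr this
      _ ≤ (1 + (b ^ n)⁻¹) / r := by gcongr; linarith
  · have hbn' : b ^ n ≤ r ^ n := pow_le_pow_left₀ hb.le hbr n
    calc 1 / r ^ n ≤ 1 / b ^ n := one_div_le_one_div_of_le (pow_pos hb n) hbn'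
      _ = (b ^ n)⁻¹ := one_div _
      _ ≤ (b ^ n)⁻¹ / r := by
          rw [le_div_iff₀ hr]
          exact mul_le_of_le_one_right hbn h1.le
      _ ≤ (1 + (b ^ n)⁻¹) / r := by gcongr; linarith

/-- `L²`: if `‖H(x)/E(x)‖ ≤ 1/‖x − p‖ⁿ` on `ℝ` with `p` non-real and `n ≥ 1`, then
`H/E ∈ L²(ℝ)`. [folklore] -/
theorem integrable_sq_of_le_inv_pow {H : ℂ → ℂ} {p : ℂ} (hp : p.im ≠ 0) {n : ℕ} (hn : 1 ≤ n)
    (hm : AEStronglyMeasurable (fun x : ℝ ↦ H x / E x) volume)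
    (hb : ∀ x : ℝ, ‖H x / E x‖ ≤ 1 / ‖(x : ℂ) - p‖ ^ n) :
    Integrable fun x : ℝ ↦ ‖H x / E x‖ ^ 2 := by
  have hb0 : 0 < |p.im| := abs_pos.2 hp
  set M : ℝ := 1 + (|p.im| ^ n)⁻¹ with hM
  have hM0 : 0 ≤ M := by positivity
  refine Integrable.mono' ((integrable_norm_inv_ofReal_sub_sq hp).const_mul (M ^ 2)) (hm.norm.pow 2)
    (ae_of_all _ fun x ↦ ?_)
  rw [Real.norm_of_nonneg (by positivity), ← mul_pow]
  refine pow_le_pow_left₀ (norm_nonneg _) ((hb x).trans ?_) 2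
  rw [norm_inv, ← div_eq_mul_inv]
  exact one_div_pow_le hn hb0 (abs_im_le_norm_ofReal_sub x p)

/-- Decay: if `‖H(z)/E(z)‖ ≤ 1/‖z − p‖ⁿ` (`n ≥ 1`) for `Im z > 0`, `‖z‖ ≥ R₁`, then
`H/E = O(1/√(Im z))` far out. [folklore] -/
theorem exists_bound_of_le_inv_pow {H : ℂ → ℂ} {p : ℂ} {n : ℕ} (hn : 1 ≤ n) {R₁ : ℝ}
    (hb : ∀ z : ℂ, 0 < z.im → R₁ ≤ ‖z‖ → ‖H z / E z‖ ≤ 1 / ‖z - p‖ ^ n) :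
    ∃ C R₀ : ℝ, ∀ z : ℂ, 0 < z.im → R₀ ≤ ‖z‖ → ‖H z / E z‖ ≤ C / √z.im := by
  refine ⟨2, max R₁ (2 * ‖p‖ + 2), fun z hz hR ↦ ?_⟩
  have hR₁ : R₁ ≤ ‖z‖ := (le_max_left _ _).trans hR
  have h2 : 2 * ‖p‖ + 2 ≤ ‖z‖ := (le_max_right _ _).trans hR
  have hp0 : 0 ≤ ‖p‖ := norm_nonneg p
  have hzp : ‖z‖ / 2 ≤ ‖z - p‖ := by
    have := norm_sub_norm_le z p
    linarith
  have h1 : 1 ≤ ‖z - p‖ := by linarith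
  have h1' : 1 ≤ ‖z‖ := by linarith
  have hsq : √z.im ≤ ‖z‖ := sqrt_im_le_norm h1'
  have hypos : 0 < √z.im := Real.sqrt_pos.2 hz
  have hpow : ‖z - p‖ ≤ ‖z - p‖ ^ n := by
    calc ‖z - p‖ = ‖z - p‖ ^ 1 := (pow_one _).symm
      _ ≤ ‖z - p‖ ^ n := pow_le_pow_right₀ h1 hn
  calc ‖H z / E z‖ ≤ 1 / ‖z - p‖ ^ n := hb z hz hR₁
    _ ≤ 1 / ‖z - p‖ := one_div_le_one_div_of_le (by linarith) hpow
    _ ≤ 1 / (‖z‖ / 2) := one_div_le_one_div_of_le (by linarith) hzp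
    _ = 2 / ‖z‖ := by rw [one_div_div]
    _ ≤ 2 / √z.im := div_le_div_of_nonneg_left (by norm_num) hypos hsq

/-- **Dividing out a zero** ("it is easy to see … `F(z)/(z − z₀)ⁿ` does not vanish at `z₀` for
some positive integer `n`"): for entire `f ≢ 0` with `f(z₀) = 0` there are `n ≥ 1` and an entire
`G` with `G(z₀) ≠ 0` and `G(z) = f(z)/(z − z₀)ⁿ` off `z₀`. [folklore] -/
theorem exists_div_pow_of_zero {f : ℂ → ℂ} (hf : Differentiable ℂ f) {z₀ z₁ : ℂ} (h0 : f z₀ = 0)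
    (h1 : f z₁ ≠ 0) :
    ∃ (n : ℕ) (G : ℂ → ℂ), 1 ≤ n ∧ Differentiable ℂ G ∧ G z₀ ≠ 0 ∧
      ∀ z : ℂ, z ≠ z₀ → G z = f z / (z - z₀) ^ n := by
  have han : AnalyticAt ℂ f z₀ := hf.analyticAt z₀
  have hne : ¬ (∀ᶠ z in 𝓝 z₀, f z = 0) := by
    intro hev
    have hfon : AnalyticOnNhd ℂ f univ := fun z _ ↦ hf.analyticAt z
    have := hfon.eqOn_zero_of_preconnected_of_eventuallyEq_zero isPreconnected_univ
      (mem_univ z₀) hev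
    exact h1 (this (mem_univ z₁))
  obtain ⟨n, g, hg, hg0, hev⟩ := han.exists_eventuallyEq_pow_smul_nonzero_iff.2 hne
  classical
  refine ⟨n, fun z ↦ if z = z₀ then g z₀ else f z / (z - z₀) ^ n, ?_, ?_, by simp [hg0], ?_⟩
  · rcases Nat.eq_zero_or_pos n with hn | hn
    · exfalso
      have := hev.self_of_nhds
      rw [hn, pow_zero, one_smul, h0] at this
      exact hg0 this.symm
    · exact hn
  · intro z
    by_cases hz : z = z₀
    · subst hz
      have heq : (fun u ↦ if u = z then g z else f u / (u - z) ^ n) =ᶠ[𝓝 z] g := by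
        filter_upwards [hev] with u hu
        by_cases huz : u = z
        · simp [huz]
        · simp only [huz, if_false]
          rw [hu, smul_eq_mul, mul_div_cancel_left₀ _ (pow_ne_zero n (sub_ne_zero.2 huz))]
      exact hg.differentiableAt.congr_of_eventuallyEq heq
    · have heq : (fun u ↦ if u = z₀ then g z₀ else f u / (u - z₀) ^ n) =ᶠ[𝓝 z]
          fun u ↦ f u / (u - z₀) ^ n := by
        filter_upwards [isOpen_ne.mem_nhds hz] with u hu
        simp [hu]
      refine DifferentiableAt.congr_of_eventuallyEq ?_ heq
      exact (hf z).div ((differentiableAt_id.sub_const z₀).pow n)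
        (pow_ne_zero n (sub_ne_zero.2 hz))
  · intro z hz
    simp [hz]

/-! ### The theorem -/

/-- **Conrey–Li 2000, Theorem 1 (de Branges' positivity theorem) holds** as stated in
`conreyLi2000_thm1`: for `E` Hermite–Biehler without real zeros, `E♯(z) = ε E(z − i)` with
`|ε| = 1`, `y ↦ |E(x + iy)|` strictly increasing on `(0, ∞)`, and `Re ⟨F, F(·+i)⟩_{𝓗(E)} ≥ 0` for
all members `F` of `𝓗(E)` (Conrey–Li's (2.1)) with `F(·+i)` a member, every zero `w` of `E` has
`Im w = −1/2` and `Re conj E′(w) E(w + i)/(2πi) ≥ 0`. Proof as printed (Conrey–Li §2), see the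
module docstring. [cite: ConreyLi2000, Theorem 1] -/
theorem conreyLi2000_thm1_holds : conreyLi2000_thm1 := by
  intro E hE hreal hε hmono hpos
  obtain ⟨ε, hεn, hfe⟩ := hε
  have hEd : Differentiable ℂ E := hE.differentiable
  have hπ : (2 * π * I : ℂ) ≠ 0 := by simp [Real.pi_ne_zero]
  have hε0 : ε ≠ 0 := fun h ↦ by simp [h] at hεn
  have hεε : conj ε * ε = 1 := by
    rw [mul_comm, Complex.mul_conj', hεn]
    norm_num
  -- zeros of `E` lie in the strip `-1 < Im w < 0`
  have hstrip : ∀ w : ℂ, E w = 0 → w.im < 0 ∧ -1 < w.im := by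
    intro w hw
    refine ⟨?_, ?_⟩
    · by_contra h
      exact hE.ne_zero_of_im_nonneg hreal (not_lt.1 h) hw
    · have h1 : sharp E (w + I) = 0 := by rw [hfe, add_sub_cancel_right, hw, mul_zero]
      have h2 : E (conj w - I) = 0 := by
        rw [sharp_apply, map_eq_zero, map_add, Complex.conj_I, ← sub_eq_add_neg] at h1
        exact h1
      by_contra h
      refine hE.ne_zero_of_im_nonneg hreal (z := conj w - I) ?_ h2
      simp only [sub_im, Complex.conj_im, Complex.I_im]
      linarith
  suffices key : ∀ w : ℂ, E w = 0 →
      w.im = -1 / 2 ∧ 0 ≤ (conj (deriv E w) * E (w + I) / (2 * π * I)).re from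
    ⟨fun w hw ↦ (key w hw).1, fun w hw ↦ (key w hw).2⟩
  intro w₀ hw₀
  obtain ⟨hneg, hgt⟩ := hstrip w₀ hw₀
  have hw₀im : w₀.im ≠ 0 := hneg.ne
  have hw₁im : (w₀ + I).im ≠ 0 := by
    simp only [add_im, Complex.I_im]
    linarith
  have hw₁pos : 0 < (w₀ + I).im := by
    simp only [add_im, Complex.I_im]
    linarith
  have hE1 : E (w₀ + I) ≠ 0 := hE.ne_zero_of_im_pos hw₁pos
  have hEs : sharp E w₀ ≠ 0 := hE.sharp_ne_zero_of_im_nonpos hreal hneg.le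
  have hE1' : conj (E (w₀ + I)) ≠ 0 := (map_ne_zero _).2 hE1
  have hEs' : conj (sharp E w₀) ≠ 0 := (map_ne_zero _).2 hEs
  have hsE1 : sharp E (w₀ + I) = 0 := by rw [hfe, add_sub_cancel_right, hw₀, mul_zero]
  -- the kernel at the zero `w₀`: `K(w₀, z) = -E♯(z) conj E♯(w₀) / (2πi (w̄₀ - z))`
  have hker : ∀ z : ℂ, deBrangesKernel E w₀ z =
      -(sharp E z * conj (sharp E w₀)) / (2 * π * I * (conj w₀ - z)) := by
    intro z
    simp only [deBrangesKernel, hw₀, map_zero, mul_zero, zero_sub]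
  -- the entire kernel function `K = K(w₀, ·)`
  obtain ⟨K, hKd, hKeq, hKval⟩ := exists_differentiable_eq_deBrangesKernel hEd w₀
  have hKx : ∀ x : ℝ, K x = deBrangesKernel E w₀ x := fun x ↦ hKeq x (by
    intro h
    have := congrArg Complex.im h
    simp only [ofReal_im, Complex.conj_im] at this
    exact hw₀im (by linarith))
  -- the shift identity (2.3): `K(z + i) = c · K(w₀ + i, z)` off `z = w̄₀ - i`
  set c : ℂ := -(ε * conj (sharp E w₀) / conj (E (w₀ + I))) with hc
  have hc0 : c ≠ 0 := by
    rw [hc, neg_ne_zero]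
    exact div_ne_zero (mul_ne_zero hε0 hEs') hE1'
  have hshift : ∀ z : ℂ, z ≠ conj w₀ - I → K (z + I) = c * deBrangesKernel E (w₀ + I) z := by
    intro z hz
    have hz' : z + I ≠ conj w₀ := fun h ↦ hz (by rw [← h]; ring)
    rw [hKeq _ hz', hker]
    simp only [deBrangesKernel, hsE1, map_zero, mul_zero, sub_zero, hc, map_add, Complex.conj_I]
    rw [hfe (z + I), add_sub_cancel_right]
    have hden : conj w₀ - (z + I) ≠ 0 := sub_ne_zero.2 (Ne.symm hz')
    have hden' : conj w₀ + -I - z ≠ 0 := by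
      convert hden using 1
      ring
    field_simp
    ring
  have hKsx : ∀ x : ℝ, K (x + I) = c * deBrangesKernel E (w₀ + I) x := fun x ↦ hshift x (by
    intro h
    have := congrArg Complex.im h
    simp only [ofReal_im, sub_im, Complex.conj_im, Complex.I_im] at this
    linarith)
  -- membership of `K`
  have hKm : AEStronglyMeasurable (fun x : ℝ ↦ K x / E x) volume :=
    aestronglyMeasurable_div hE hreal hKd
  have hK2 : Integrable fun x : ℝ ↦ ‖K x / E x‖ ^ 2 := by
    simp_rw [hKx]
    exact integrable_sq_norm_deBrangesKernel_div hE hreal hw₀im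
  have hKb := exists_joint_bound_kernel hE hreal hw₀im hKeq
  have hKkb : HasKernelBound E K := hasKernelBound_of_bound hE hreal hKd hK2 hKb
  -- membership of `K(· + i)`
  have hKsd : Differentiable ℂ (fun z ↦ K (z + I)) := fun z ↦
    (hKd (z + I)).comp z (differentiableAt_id.add_const I)
  have hKsm : AEStronglyMeasurable (fun x : ℝ ↦ K (x + I) / E x) volume :=
    aestronglyMeasurable_div hE hreal hKsd
  have hKs2 : Integrable fun x : ℝ ↦ ‖K (x + I) / E x‖ ^ 2 := by
    simp_rw [hKsx]
    refine ((integrable_sq_norm_deBrangesKernel_div hE hreal hw₁im).const_mul (‖c‖ ^ 2)).congr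
      (ae_of_all _ fun x ↦ ?_)
    simp only [mul_div_assoc, norm_mul, mul_pow]
  have hKsb : ∃ C R₀ : ℝ, ∀ z : ℂ, 0 < z.im → R₀ ≤ ‖z‖ →
      ‖K (z + I) / E z‖ ≤ C / √z.im ∧ ‖sharp (fun u ↦ K (u + I)) z / E z‖ ≤ C / √z.im := by
    have hK'eq : ∀ z : ℂ, z ≠ conj (w₀ + I) →
        (fun u ↦ c⁻¹ * K (u + I)) z = deBrangesKernel E (w₀ + I) z := by
      intro z hz
      have hz' : z ≠ conj w₀ - I := by
        rwa [map_add, Complex.conj_I, ← sub_eq_add_neg] at hz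
      simp only
      rw [hshift z hz', ← mul_assoc, inv_mul_cancel₀ hc0, one_mul]
    have h := exists_joint_bound_const_mul c (exists_joint_bound_kernel hE hreal hw₁im hK'eq)
    simp_rw [mul_inv_cancel_left₀ hc0] at h
    exact h
  have hKskb : HasKernelBound E (fun z ↦ K (z + I)) :=
    hasKernelBound_of_bound hE hreal hKsd hKs2 hKsb
  -- `⟨K, K(·+i)⟩ = conj K(w₀ + i)` by the reproducing identity (2.2)
  have hPKK : deBrangesInner E K (fun z ↦ K (z + I)) = conj (K (w₀ + I)) := by
    rw [deBrangesInner_conj_symm, deBrangesInner_congr_right (F := fun z ↦ K (z + I)) (G := K)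
      (G' := deBrangesKernel E w₀) hKx,
      deBrangesInner_deBrangesKernel hE hreal hKsd hKs2 hKsb hw₀im]
  ------------------------------------------------------------------
  -- First conclusion: `Im w₀ = -1/2` (by contradiction, Conrey–Li (2.4)–(2.5))
  ------------------------------------------------------------------
  have him : w₀.im = -1 / 2 := by
    by_contra him
    -- then `K(w₀ + i) = 0`
    have hK0 : K (w₀ + I) = 0 := by
      have hne : w₀ + I ≠ conj w₀ := by
        intro h
        apply him
        have := congrArg Complex.im h
        simp only [add_im, Complex.I_im, Complex.conj_im] at this
        linarith
      rw [hKeq _ hne, hker, hsE1, zero_mul, neg_zero, zero_div]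
    -- the member `G = E♯/(· - w₀ - i)ⁿ` with `G(w₀ + i) ≠ 0`
    obtain ⟨n, G, hn, hGd, hG0, hGeq⟩ :=
      exists_div_pow_of_zero (differentiable_sharp hEd) (z₀ := w₀ + I) (z₁ := w₀) hsE1 hEs
    have hGm : AEStronglyMeasurable (fun x : ℝ ↦ G x / E x) volume :=
      aestronglyMeasurable_div hE hreal hGd
    have hGsd : Differentiable ℂ (fun z ↦ G (z + I)) := fun z ↦
      (hGd (z + I)).comp z (differentiableAt_id.add_const I)
    have hGsm : AEStronglyMeasurable (fun x : ℝ ↦ G (x + I) / E x) volume :=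
      aestronglyMeasurable_div hE hreal hGsd
    -- values of `G`, `G♯`, `G(·+i)`, `G(·+i)♯` divided by `E`
    have hGv : ∀ z : ℂ, z ≠ w₀ + I → G z / E z = sharp E z / E z / (z - (w₀ + I)) ^ n := by
      intro z hz
      rw [hGeq z hz, div_right_comm]
    have hGsv : ∀ z : ℂ, z ≠ conj w₀ - I → E z ≠ 0 →
        sharp G z / E z = 1 / (z - (conj w₀ - I)) ^ n := by
      intro z hz hEz
      have hz' : conj z ≠ w₀ + I := by
        intro h
        apply hz
        rw [← Complex.conj_conj z, h, map_add, Complex.conj_I, sub_eq_add_neg]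
      rw [sharp_apply, hGeq _ hz', map_div₀, map_pow, map_sub, map_add, Complex.conj_I,
        Complex.conj_conj, ← sub_eq_add_neg, div_right_comm]
      have : conj (sharp E (conj z)) = E z := by simp [sharp_apply]
      rw [this, div_self hEz]
    have hGshift : ∀ z : ℂ, z ≠ w₀ → G (z + I) = ε * E z / (z - w₀) ^ n := by
      intro z hz
      have hz' : z + I ≠ w₀ + I := fun h ↦ hz (add_right_cancel h)
      rw [hGeq _ hz', hfe, add_sub_cancel_right, add_sub_add_right_eq_sub]
    have hGsv' : ∀ z : ℂ, z ≠ w₀ → E z ≠ 0 → G (z + I) / E z = ε / (z - w₀) ^ n := by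
      intro z hz hEz
      rw [hGshift z hz, div_right_comm, mul_div_assoc, div_self hEz, mul_one]
    have hGssv : ∀ z : ℂ, z ≠ conj w₀ →
        sharp (fun u ↦ G (u + I)) z / E z = conj ε * (sharp E z / E z) / (z - conj w₀) ^ n := by
      intro z hz
      have hz' : conj z ≠ w₀ := fun h ↦ hz (by rw [← Complex.conj_conj z, h])
      simp only [sharp_apply]
      rw [hGshift _ hz', map_div₀, map_mul, map_pow, map_sub, Complex.conj_conj]
      ring
    -- membership of `G`
    have hb1 : ∀ x : ℝ, ‖G x / E x‖ ≤ 1 / ‖(x : ℂ) - (w₀ + I)‖ ^ n := by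
      intro x
      have hx : (x : ℂ) ≠ w₀ + I := by
        intro h
        have := congrArg Complex.im h
        simp only [ofReal_im, add_im, Complex.I_im] at this
        linarith
      rw [hGv _ hx, norm_div, norm_div, norm_pow, sharp_ofReal, Complex.norm_conj,
        div_self (norm_ne_zero_iff.2 (hreal x))]
    have hG2 : Integrable fun x : ℝ ↦ ‖G x / E x‖ ^ 2 :=
      integrable_sq_of_le_inv_pow hw₁im hn hGm hb1
    have hb1' : ∀ z : ℂ, 0 < z.im → ‖w₀ + I‖ + 1 ≤ ‖z‖ →
        ‖G z / E z‖ ≤ 1 / ‖z - (w₀ + I)‖ ^ n := by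
      intro z hz hR
      have hz' : z ≠ w₀ + I := by
        rintro rfl
        linarith
      have hEz : E z ≠ 0 := hE.ne_zero_of_im_pos hz
      rw [hGv _ hz', norm_div _ ((z - (w₀ + I)) ^ n), norm_pow]
      refine div_le_div_of_nonneg_right ?_ (by positivity)
      rw [norm_div, div_le_one (norm_pos_iff.2 hEz)]
      exact hE.norm_sharp_le hz.le
    have hb2' : ∀ z : ℂ, 0 < z.im → 0 ≤ ‖z‖ →
        ‖sharp G z / E z‖ ≤ 1 / ‖z - (conj w₀ - I)‖ ^ n := by
      intro z hz _
      have hz' : z ≠ conj w₀ - I := by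
        intro h
        have := congrArg Complex.im h
        simp only [sub_im, Complex.conj_im, Complex.I_im] at this
        linarith
      rw [hGsv _ hz' (hE.ne_zero_of_im_pos hz), norm_div, norm_one, norm_pow]
    have hGb := exists_joint_bound (E := E) (F := G) (exists_bound_of_le_inv_pow hn hb1')
      (exists_bound_of_le_inv_pow hn hb2')
    -- membership of `G(· + i)`
    have hb3 : ∀ x : ℝ, ‖G (x + I) / E x‖ ≤ 1 / ‖(x : ℂ) - w₀‖ ^ n := by
      intro x
      have hx : (x : ℂ) ≠ w₀ := by
        intro h
        have := congrArg Complex.im h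
        simp only [ofReal_im] at this
        exact hw₀im this.symm
      rw [hGsv' _ hx (hreal x), norm_div, hεn, norm_pow]
    have hGs2 : Integrable fun x : ℝ ↦ ‖G (x + I) / E x‖ ^ 2 :=
      integrable_sq_of_le_inv_pow (H := fun u ↦ G (u + I)) hw₀im hn hGsm hb3
    have hb3' : ∀ z : ℂ, 0 < z.im → 0 ≤ ‖z‖ → ‖G (z + I) / E z‖ ≤ 1 / ‖z - w₀‖ ^ n := by
      intro z hz _
      have hz' : z ≠ w₀ := by
        rintro rfl
        linarith
      rw [hGsv' _ hz' (hE.ne_zero_of_im_pos hz), norm_div, hεn, norm_pow]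
    have hb4' : ∀ z : ℂ, 0 < z.im → ‖w₀‖ + 1 ≤ ‖z‖ →
        ‖sharp (fun u ↦ G (u + I)) z / E z‖ ≤ 1 / ‖z - conj w₀‖ ^ n := by
      intro z hz hR
      have hz' : z ≠ conj w₀ := by
        intro h
        rw [h, Complex.norm_conj] at hR
        linarith
      have hEz := hE.ne_zero_of_im_pos hz
      rw [hGssv _ hz', norm_div _ ((z - conj w₀) ^ n), norm_mul, Complex.norm_conj, hεn, one_mul,
        norm_pow]
      refine div_le_div_of_nonneg_right ?_ (by positivity)
      rw [norm_div, div_le_one (norm_pos_iff.2 hEz)]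
      exact hE.norm_sharp_le hz.le
    have hGsb := exists_joint_bound (E := E) (F := fun u ↦ G (u + I))
      (exists_bound_of_le_inv_pow (H := fun u ↦ G (u + I)) hn hb3')
      (exists_bound_of_le_inv_pow (H := sharp fun u ↦ G (u + I)) hn hb4')
    -- positivity for `G + μ K`, for every `μ`
    have hineq : ∀ μ : ℂ, 0 ≤ (deBrangesInner E (fun z ↦ G z + μ * K z)
        (fun z ↦ G (z + I) + μ * K (z + I))).re := by
      intro μ
      have hFd : Differentiable ℂ (fun z ↦ G z + μ * K z) := hGd.add (hKd.const_mul μ)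
      have hFsd : Differentiable ℂ (fun z ↦ G (z + I) + μ * K (z + I)) :=
        hGsd.add (hKsd.const_mul μ)
      have hF2 := integrable_sq_add_mul μ hGm hKm hG2 hK2
      have hFs2 := integrable_sq_add_mul (F := fun u ↦ G (u + I)) (G := fun u ↦ K (u + I)) μ
        hGsm hKsm hGs2 hKs2
      have hFb := exists_joint_bound_add_mul (F := G) (G := K) μ hGb hKb
      have hFsb := exists_joint_bound_add_mul (F := fun u ↦ G (u + I)) (G := fun u ↦ K (u + I)) μ
        hGsb hKsb
      have hFkb := hasKernelBound_of_bound hE hreal hFd hF2 hFb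
      have hFskb := hasKernelBound_of_bound hE hreal hFsd hFs2 hFsb
      exact hpos (fun z ↦ G z + μ * K z) ⟨hFd, hF2, hFkb⟩ ⟨hFsd, hFs2, hFskb⟩
    -- the four pairings, evaluated by the reproducing identity ((2.2), (2.4))
    have h1 := integrable_inner_integrand (F := G) (G := fun u ↦ G (u + I)) hreal hGm hGsm hG2 hGs2
    have h2 := integrable_inner_integrand (F := G) (G := fun u ↦ K (u + I)) hreal hGm hKsm hG2 hKs2
    have h3 := integrable_inner_integrand (F := K) (G := fun u ↦ G (u + I)) hreal hKm hGsm hK2 hGs2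
    have h4 := integrable_inner_integrand (F := K) (G := fun u ↦ K (u + I)) hreal hKm hKsm hK2 hKs2
    have hPGKs : deBrangesInner E G (fun z ↦ K (z + I)) = conj c * G (w₀ + I) := by
      rw [deBrangesInner_congr_right (F := G) (G := fun z ↦ K (z + I))
        (G' := fun z ↦ c * deBrangesKernel E (w₀ + I) z) hKsx, deBrangesInner_const_mul_right,
        deBrangesInner_deBrangesKernel hE hreal hGd hG2 hGb hw₁im]
    have hPGsK : deBrangesInner E (fun z ↦ G (z + I)) K = G (w₀ + I) := by
      rw [deBrangesInner_congr_right (F := fun z ↦ G (z + I)) (G := K)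
        (G' := deBrangesKernel E w₀) hKx,
        deBrangesInner_deBrangesKernel hE hreal hGsd hGs2 hGsb hw₀im]
    have hPKGs : deBrangesInner E K (fun z ↦ G (z + I)) = conj (G (w₀ + I)) := by
      rw [deBrangesInner_conj_symm, hPGsK]
    -- the Schwarz-inequality step (2.5): `(conj c + 1) G(w₀ + i) = 0`
    have hS : (conj c + 1) * G (w₀ + I) = 0 := by
      by_contra hS
      set S : ℂ := (conj c + 1) * G (w₀ + I) with hSdef
      set a : ℝ := (deBrangesInner E G (fun z ↦ G (z + I))).re with ha
      have hS2 : 0 < ‖S‖ ^ 2 := pow_pos (norm_pos_iff.2 hS) 2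
      set t : ℝ := (a + 1) / ‖S‖ ^ 2 with ht
      have htS : t * ‖S‖ ^ 2 = a + 1 := by
        rw [ht, div_mul_cancel₀ _ hS2.ne']
      have key := hineq (-(t : ℂ) * S)
      rw [deBrangesInner_add_mul_expand (A := G) (B := K) (A' := fun u ↦ G (u + I))
        (B' := fun u ↦ K (u + I)) _ h1 h2 h3 h4, hPGKs, hPKGs, hPKK, hK0] at key
      have e1 : (-(t : ℂ) * S * conj (G (w₀ + I))).re = (conj (-(t : ℂ) * S) * G (w₀ + I)).re := by
        rw [← Complex.conj_re (-(t : ℂ) * S * conj (G (w₀ + I))), map_mul, Complex.conj_conj]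
      have e2 : conj (-(t : ℂ) * S) * (conj c * G (w₀ + I)) + conj (-(t : ℂ) * S) * G (w₀ + I) =
          (((-(t * ‖S‖ ^ 2) : ℝ)) : ℂ) := by
        rw [← mul_add, show conj c * G (w₀ + I) + G (w₀ + I) = S by rw [hSdef]; ring, map_mul,
          map_neg, Complex.conj_ofReal, show -(t : ℂ) * conj S * S = -((t : ℂ) * (conj S * S)) by ring,
          Complex.conj_mul' S]
        push_cast
        ring
      have hre : (deBrangesInner E G (fun z ↦ G (z + I)) +
          conj (-(t : ℂ) * S) * (conj c * G (w₀ + I)) + -(t : ℂ) * S * conj (G (w₀ + I)) +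
          -(t : ℂ) * S * conj (-(t : ℂ) * S) * conj 0).re = a - t * ‖S‖ ^ 2 := by
        rw [map_zero, mul_zero, add_zero, Complex.add_re, Complex.add_re, add_assoc, e1,
          ← Complex.add_re, e2, Complex.ofReal_re, ← ha]
        ring
      rw [hre, htS] at key
      linarith
    -- hence `conj c = -1`, i.e. `E(w₀ + i) = E(w₀ - i)`
    have hc1 : conj c = -1 := by
      rcases mul_eq_zero.1 hS with h | h
      · linear_combination h
      · exact absurd h hG0
    have hEeq : E (w₀ + I) = E (w₀ - I) := by
      have h' : c = -1 := by rw [← Complex.conj_conj c, hc1, map_neg, map_one]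
      rw [hc, neg_inj, div_eq_one_iff_eq hE1'] at h'
      have h3 := congrArg conj h'
      rw [map_mul, Complex.conj_conj, Complex.conj_conj, hfe w₀, ← mul_assoc, hεε, one_mul] at h3
      exact h3.symm
    -- `|E(x + i(1 + y))| = |E(x - iy)|` contradicts strict monotonicity unless `y = -1/2`
    have hnorm : ‖E (w₀ + I)‖ = ‖E (conj w₀)‖ := by
      rw [hEeq, ← norm_sharp, hfe w₀, norm_mul, hεn, one_mul]
    have hy1 : w₀.im + 1 ∈ Set.Ioi (0 : ℝ) := by
      simp only [Set.mem_Ioi]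
      linarith
    have hy2 : -w₀.im ∈ Set.Ioi (0 : ℝ) := by
      simp only [Set.mem_Ioi]
      linarith
    have hp1 : (w₀.re : ℂ) + ((w₀.im + 1 : ℝ) : ℂ) * I = w₀ + I := by
      apply Complex.ext <;> simp
    have hp2 : (w₀.re : ℂ) + ((-w₀.im : ℝ) : ℂ) * I = conj w₀ := by
      apply Complex.ext <;> simp
    have heq : (fun y : ℝ ↦ ‖E (w₀.re + y * I)‖) (w₀.im + 1) =
        (fun y : ℝ ↦ ‖E (w₀.re + y * I)‖) (-w₀.im) := by
      simp only [hp1, hp2, hnorm]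
    have := (hmono w₀.re).injOn hy1 hy2 heq
    apply him
    linarith
  ------------------------------------------------------------------
  -- Second conclusion: `Re K(w₀, w₀ + i) ≥ 0` with `w̄₀ = w₀ + i`
  ------------------------------------------------------------------
  refine ⟨him, ?_⟩
  have hconj : conj w₀ = w₀ + I := Complex.ext (by simp) (by simp [him]; norm_num)
  have h := hpos K ⟨hKd, hK2, hKkb⟩ ⟨hKsd, hKs2, hKskb⟩
  rw [hPKK, Complex.conj_re, ← hconj, hKval, hw₀, map_zero, mul_zero, sub_zero, hconj] at h
  exact h

end Literature.Analysis.DeBrangesSpaces
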